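import Mathlib
import HarnessLib
import Literature.Analysis.FluidPDE.LinearizedNSTorus
import Literature.Analysis.FunctionSpaces.TorusCalculusProofs
import Literature.Analysis.FunctionSpaces.TorusMollifierEstimates
import Literature.Analysis.FunctionSpaces.TorusSpaceTime

/-!
# Stub `stub_axisZeroOfAxisTwo` of the line `Sketch` (crux stmt-AnomalousDissipation-10430,
# `ImpulseGrid.BoundedEnergyGrid`): columnar steady branch, axis `2` ⇒ axis `0`

Registered signature (proved here with the skeleton's local notations `𝕋³ = UnitAddTorus (Fin 3)`,
`E³ = EuclideanSpace ℝ (Fin 3)` written out, so that the file declares no notation):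
```
theorem stub_axisZeroOfAxisTwo :
    (∃ G : 𝕋³ → E³, IsSmooth G ∧ (∀ (s : UnitAddCircle) x, G (x + Pi.single (2 : Fin 3) s) = G x) ∧
      (∀ x, G x 2 = 0) ∧ IsDivFree G ∧ HasZeroMean G ∧ G ≠ 0 ∧
      ∃ (ν : ℕ → ℝ) (V : ℕ → 𝕋³ → E³) (p : ℕ → 𝕋³ → ℝ),
        (∀ j, 0 < ν j) ∧ Tendsto ν atTop (𝓝 0) ∧
        (∀ j, IsSteadyNSState (ν j) G (V j) (p j)) ∧
        (∀ j (s : UnitAddCircle) x, V j (x + Pi.single (2 : Fin 3) s) = V j x) ∧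
        (∀ j x, V j x 2 = 0) ∧ (∀ j, HasZeroMean (V j)) ∧
        ∃ E : ℝ, ∀ j, ∫ x, ‖V j x‖ ^ 2 ≤ E) →
    ∃ G : 𝕋³ → E³, IsSmooth G ∧ (∀ (s : UnitAddCircle) x, G (x + Pi.single (0 : Fin 3) s) = G x) ∧
      (∀ x, G x 0 = 0) ∧ IsDivFree G ∧ HasZeroMean G ∧ G ≠ 0 ∧
      ∃ (ν : ℕ → ℝ) (V : ℕ → 𝕋³ → E³) (p : ℕ → 𝕋³ → ℝ),
        (∀ j, 0 < ν j) ∧ Tendsto ν atTop (𝓝 0) ∧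
        (∀ j, IsSteadyNSState (ν j) G (V j) (p j)) ∧
        (∀ j (s : UnitAddCircle) x, V j (x + Pi.single (0 : Fin 3) s) = V j x) ∧
        (∀ j x, V j x 0 = 0) ∧ (∀ j, HasZeroMean (V j)) ∧
        ∃ E : ℝ, ∀ j, ∫ x, ‖V j x‖ ^ 2 ≤ E
```

The step is pure symmetry: the steady forced incompressible Navier–Stokes system on the flat
torus `T³` is equivariant under the coordinate swap `σ = Equiv.swap (0 : Fin 3) 2`, an involutive
lattice isometry. With `P x := x ∘ σ` on `T³` (written inline as `fun i => x (σ i)`) and the linear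
isometry `A := LinearIsometryEquiv.piLpCongrLeft 2 ℝ ℝ σ` of `ℝ³` (`(A w) i = w (σ i)`,
`A ∘ A = id`), a columnar branch `(G, V_j, p_j)` with invariant axis `2` is carried to the
conjugated branch `(A ∘ G ∘ P, A ∘ V_j ∘ P, p_j ∘ P)` with invariant axis `0`, the same `ν_j` and
the same energy bound `E`. Ingredients: `∂ᵥ(w ∘ P)(x) = ∂_{A v} w (P x)` and
`lift (w ∘ P) = lift w ∘ A` hold by `rfl`, `A eᵢ = e_{σ i}`, and `A` commutes with `deriv`; hence
`∂ᵢ (A ∘ w ∘ P) = A ∘ (∂_{σ i} w) ∘ P`, and `div`, `(·∇)·` (`C¹` fields,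
`Torus.lineDeriv_eq_fderiv_apply`), `Δ` (smooth fields, `Torus.laplacian_eq_sum_partialDeriv_partialDeriv`,
reindexing `∑` by `σ`) and `∇` (`Torus.gradient_apply`) commute with the conjugation; steady paths
are jointly smooth (`Torus.isSmoothSpaceTimeOn_const`) with vanishing one-sided time derivative;
`P` is the inverse of the measurable equivalence `MeasurableEquiv.piCongrLeft _ σ`, which preserves
`volume` (`MeasureTheory.volume_measurePreserving_piCongrLeft`), so zero mean and `∫ ‖·‖²` are
preserved (`A` is an isometry commuting with the Bochner integral); finally
`P (x + s e₀) = P x + s e₂` and `(A w) 0 = w 2`.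

Pure proof file (no definitions, no notation): the conjugated fields are written inline.
-/

-- `Summit.<Summit>.<Problem>` is the tree's mandated summit-side namespace (CONVENTIONS §2); for
-- this single-conjunct summit the two coincide, so the duplicate is deliberate.
set_option linter.dupNamespace false

noncomputable section

open MeasureTheory Filter Topology Set
open Literature.Analysis.FunctionSpaces Literature.Analysis.FunctionSpaces.Torus
open Literature.Analysis.FluidPDE Literature.Analysis.FluidPDE.Torus

namespace Summit.AnomalousDissipation.AnomalousDissipation.Theorems

/-- `A` is an involution. [folklore] -/
theorem piLpCongrLeft_swap_swap (v : EuclideanSpace ℝ (Fin 3)) :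
    LinearIsometryEquiv.piLpCongrLeft 2 ℝ ℝ (Equiv.swap (0 : Fin 3) 2)
      (LinearIsometryEquiv.piLpCongrLeft 2 ℝ ℝ (Equiv.swap (0 : Fin 3) 2) v) = v := by
  ext i
  simp

/-- `A eᵢ = e_{σ i}` on the standard basis. [folklore] -/
theorem piLpCongrLeft_swap_single (i : Fin 3) :
    LinearIsometryEquiv.piLpCongrLeft 2 ℝ ℝ (Equiv.swap (0 : Fin 3) 2)
        (EuclideanSpace.single i (1 : ℝ)) =
      EuclideanSpace.single (Equiv.swap (0 : Fin 3) 2 i) 1 := by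
  simp

/-- `P ∘ P = id` on `T³`, coordinatewise. [folklore] -/
theorem swap_swap_coord (y : UnitAddTorus (Fin 3)) :
    (fun i => (fun k => y (Equiv.swap (0 : Fin 3) 2 k)) (Equiv.swap (0 : Fin 3) 2 i)) = y := by
  funext i
  simp

/-- `P (x + s e₀) = P x + s e₂`: translations along axis `0` become translations along axis `2`.
[folklore] -/
theorem swap_coord_add_single_zero (x : UnitAddTorus (Fin 3)) (s : UnitAddCircle) :
    (fun i => (x + Pi.single (0 : Fin 3) s : UnitAddTorus (Fin 3)) (Equiv.swap (0 : Fin 3) 2 i)) =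
      (fun i => x (Equiv.swap (0 : Fin 3) 2 i)) + Pi.single (2 : Fin 3) s := by
  funext i
  fin_cases i <;> simp [Equiv.swap_apply_def]

/-- A function invariant along axis `2` becomes, after precomposition with `P`, invariant along
axis `0`. [folklore] -/
theorem comp_swap_add_single_zero {β : Type*} (w : UnitAddTorus (Fin 3) → β)
    (hw : ∀ (s : UnitAddCircle) x, w (x + Pi.single (2 : Fin 3) s) = w x) (s : UnitAddCircle)
    (x : UnitAddTorus (Fin 3)) :
    w (fun i => (x + Pi.single (0 : Fin 3) s : UnitAddTorus (Fin 3)) (Equiv.swap (0 : Fin 3) 2 i))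
      = w (fun i => x (Equiv.swap (0 : Fin 3) 2 i)) := by
  rw [swap_coord_add_single_zero, hw]

/-- **Change of variables** `∫_{T³} g (P x) dx = ∫_{T³} g`: `P` is the inverse of the measurable
equivalence `MeasurableEquiv.piCongrLeft _ σ`, which preserves the product measure. [folklore] -/
theorem integral_comp_swap {F : Type*} [NormedAddCommGroup F] [NormedSpace ℝ F]
    (g : UnitAddTorus (Fin 3) → F) :
    ∫ x : UnitAddTorus (Fin 3), g (fun i => x (Equiv.swap (0 : Fin 3) 2 i)) = ∫ x, g x :=
  ((MeasureTheory.volume_measurePreserving_piCongrLeft (fun _ : Fin 3 => UnitAddCircle)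
    (Equiv.swap (0 : Fin 3) 2)).symm _).integral_comp' g

/-- The conjugation preserves `∫ ‖·‖²` (`A` is an isometry, `P` is measure preserving).
[folklore] -/
theorem integral_norm_sq_conj_swap (w : UnitAddTorus (Fin 3) → EuclideanSpace ℝ (Fin 3)) :
    ∫ x : UnitAddTorus (Fin 3), ‖LinearIsometryEquiv.piLpCongrLeft 2 ℝ ℝ (Equiv.swap (0 : Fin 3) 2)
        (w (fun i => x (Equiv.swap (0 : Fin 3) 2 i)))‖ ^ 2 = ∫ x, ‖w x‖ ^ 2 := by
  simp_rw [LinearIsometryEquiv.norm_map]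
  exact integral_comp_swap (fun y => ‖w y‖ ^ 2)

/-- The conjugation preserves zero mean (`A` commutes with the Bochner integral). [folklore] -/
theorem hasZeroMean_conj_swap {w : UnitAddTorus (Fin 3) → EuclideanSpace ℝ (Fin 3)}
    (hw : HasZeroMean w) :
    HasZeroMean (fun x : UnitAddTorus (Fin 3) =>
      LinearIsometryEquiv.piLpCongrLeft 2 ℝ ℝ (Equiv.swap (0 : Fin 3) 2)
        (w (fun i => x (Equiv.swap (0 : Fin 3) 2 i)))) := by
  unfold HasZeroMean at hw ⊢
  change ∫ x : UnitAddTorus (Fin 3),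
    (LinearIsometryEquiv.piLpCongrLeft 2 ℝ ℝ (Equiv.swap (0 : Fin 3) 2)).toContinuousLinearEquiv
      (w (fun i => x (Equiv.swap (0 : Fin 3) 2 i))) = 0
  rw [ContinuousLinearEquiv.integral_comp_comm, integral_comp_swap (fun y => w y), hw, map_zero]

/-- `lift (w ∘ P) = lift w ∘ A` (definitionally). [folklore] -/
theorem lift_comp_swap {F : Type*} (w : UnitAddTorus (Fin 3) → F) :
    lift (fun x : UnitAddTorus (Fin 3) => w (fun i => x (Equiv.swap (0 : Fin 3) 2 i))) =
      lift w ∘ LinearIsometryEquiv.piLpCongrLeft 2 ℝ ℝ (Equiv.swap (0 : Fin 3) 2) :=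
  rfl

/-- `Cⁿ` functions stay `Cⁿ` after precomposition with `P`; with `n = ∞` (definitionally
`IsSmooth`) smooth functions stay smooth. [folklore] -/
theorem isContDiff_comp_swap {F : Type*} [NormedAddCommGroup F] [NormedSpace ℝ F]
    {n : WithTop ℕ∞} {w : UnitAddTorus (Fin 3) → F} (hw : IsContDiff n w) :
    IsContDiff n (fun x : UnitAddTorus (Fin 3) => w (fun i => x (Equiv.swap (0 : Fin 3) 2 i))) := by
  change ContDiff ℝ n
    (lift fun x : UnitAddTorus (Fin 3) => w (fun i => x (Equiv.swap (0 : Fin 3) 2 i)))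
  rw [lift_comp_swap]
  exact hw.comp (LinearIsometryEquiv.piLpCongrLeft 2 ℝ ℝ (Equiv.swap (0 : Fin 3) 2)).contDiff

/-- `Cⁿ` vector fields stay `Cⁿ` after conjugation `w ↦ A ∘ w ∘ P` (again including `n = ∞`).
[folklore] -/
theorem isContDiff_conj_swap {n : WithTop ℕ∞}
    {w : UnitAddTorus (Fin 3) → EuclideanSpace ℝ (Fin 3)} (hw : IsContDiff n w) :
    IsContDiff n (fun x : UnitAddTorus (Fin 3) =>
      LinearIsometryEquiv.piLpCongrLeft 2 ℝ ℝ (Equiv.swap (0 : Fin 3) 2)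
        (w (fun i => x (Equiv.swap (0 : Fin 3) 2 i)))) := by
  change ContDiff ℝ n (⇑(LinearIsometryEquiv.piLpCongrLeft 2 ℝ ℝ (Equiv.swap (0 : Fin 3) 2)) ∘
    lift fun x : UnitAddTorus (Fin 3) => w (fun i => x (Equiv.swap (0 : Fin 3) 2 i)))
  exact (LinearIsometryEquiv.piLpCongrLeft 2 ℝ ℝ (Equiv.swap (0 : Fin 3) 2)).contDiff.comp
    (isContDiff_comp_swap hw)

/-- Directional derivatives of `w ∘ P`: `∂ᵥ(w ∘ P)(x) = ∂_{A v} w (P x)` (pure rewriting of the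
difference quotients, no differentiability needed; holds by `rfl`). [folklore] -/
theorem lineDeriv_comp_swap {F : Type*} [NormedAddCommGroup F] [NormedSpace ℝ F]
    (w : UnitAddTorus (Fin 3) → F) (x : UnitAddTorus (Fin 3)) (v : EuclideanSpace ℝ (Fin 3)) :
    Torus.lineDeriv (fun y : UnitAddTorus (Fin 3) => w (fun i => y (Equiv.swap (0 : Fin 3) 2 i)))
        x v =
      Torus.lineDeriv w (fun i => x (Equiv.swap (0 : Fin 3) 2 i))
        (LinearIsometryEquiv.piLpCongrLeft 2 ℝ ℝ (Equiv.swap (0 : Fin 3) 2) v) :=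
  rfl

/-- The linear isometry `A` commutes with directional derivatives (a continuous linear
equivalence commutes with `deriv`, differentiable or not). [folklore] -/
theorem lineDeriv_piLpCongrLeft_comp (w : UnitAddTorus (Fin 3) → EuclideanSpace ℝ (Fin 3))
    (x : UnitAddTorus (Fin 3)) (v : EuclideanSpace ℝ (Fin 3)) :
    Torus.lineDeriv
        (fun y => LinearIsometryEquiv.piLpCongrLeft 2 ℝ ℝ (Equiv.swap (0 : Fin 3) 2) (w y)) x v =
      LinearIsometryEquiv.piLpCongrLeft 2 ℝ ℝ (Equiv.swap (0 : Fin 3) 2)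
        (Torus.lineDeriv w x v) := by
  unfold Torus.lineDeriv
  rw [← fderiv_apply_one_eq_deriv, ← fderiv_apply_one_eq_deriv]
  have h : (fun t : ℝ => LinearIsometryEquiv.piLpCongrLeft 2 ℝ ℝ (Equiv.swap (0 : Fin 3) 2)
      (w (x + proj (t • v)))) =
      ⇑(LinearIsometryEquiv.piLpCongrLeft 2 ℝ ℝ (Equiv.swap (0 : Fin 3) 2)) ∘
        (fun t : ℝ => w (x + proj (t • v))) := rfl
  rw [h, LinearIsometryEquiv.comp_fderiv]
  rfl

/-- Partial derivatives of `w ∘ P`: `∂ᵢ (w ∘ P) = (∂_{σ i} w) ∘ P`. [folklore] -/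
theorem partialDeriv_comp_swap {F : Type*} [NormedAddCommGroup F] [NormedSpace ℝ F]
    (w : UnitAddTorus (Fin 3) → F) (i : Fin 3) (x : UnitAddTorus (Fin 3)) :
    partialDeriv i
        (fun y : UnitAddTorus (Fin 3) => w (fun k => y (Equiv.swap (0 : Fin 3) 2 k))) x =
      partialDeriv (Equiv.swap (0 : Fin 3) 2 i) w (fun k => x (Equiv.swap (0 : Fin 3) 2 k)) := by
  rw [partialDeriv, lineDeriv_comp_swap, piLpCongrLeft_swap_single]
  rfl

/-- Partial derivatives of conjugated fields: `∂ᵢ (A ∘ w ∘ P) = A ∘ (∂_{σ i} w) ∘ P`.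
[folklore] -/
theorem partialDeriv_conj_swap (w : UnitAddTorus (Fin 3) → EuclideanSpace ℝ (Fin 3))
    (i : Fin 3) :
    partialDeriv i (fun y : UnitAddTorus (Fin 3) =>
        LinearIsometryEquiv.piLpCongrLeft 2 ℝ ℝ (Equiv.swap (0 : Fin 3) 2)
          (w (fun k => y (Equiv.swap (0 : Fin 3) 2 k)))) =
      fun x : UnitAddTorus (Fin 3) =>
        LinearIsometryEquiv.piLpCongrLeft 2 ℝ ℝ (Equiv.swap (0 : Fin 3) 2)
          (partialDeriv (Equiv.swap (0 : Fin 3) 2 i) w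
            (fun k => x (Equiv.swap (0 : Fin 3) 2 k))) := by
  funext x
  rw [partialDeriv, lineDeriv_piLpCongrLeft_comp, lineDeriv_comp_swap,
    piLpCongrLeft_swap_single]
  rfl

/-- **Divergence of conjugated fields**: `div (A ∘ w ∘ P) = (div w) ∘ P` (reindex `∑ᵢ` by `σ`;
no differentiability needed); in particular conjugation preserves incompressibility.
[folklore] -/
theorem divergence_conj_swap (w : UnitAddTorus (Fin 3) → EuclideanSpace ℝ (Fin 3))
    (x : UnitAddTorus (Fin 3)) :
    divergence (fun y : UnitAddTorus (Fin 3) =>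
        LinearIsometryEquiv.piLpCongrLeft 2 ℝ ℝ (Equiv.swap (0 : Fin 3) 2)
          (w (fun k => y (Equiv.swap (0 : Fin 3) 2 k)))) x =
      divergence w (fun k => x (Equiv.swap (0 : Fin 3) 2 k)) := by
  simp only [Torus.divergence, LinearIsometryEquiv.piLpCongrLeft_apply, Equiv.piCongrLeft'_apply,
    Equiv.symm_swap]
  rw [← Equiv.sum_comp (Equiv.swap (0 : Fin 3) 2)
    (fun j => partialDeriv j (fun z => w z j) (fun k => x (Equiv.swap (0 : Fin 3) 2 k)))]
  exact Finset.sum_congr rfl fun i _ =>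
    partialDeriv_comp_swap (fun z => w z (Equiv.swap (0 : Fin 3) 2 i)) i x

/-- **Convective term of conjugated fields**: `((AwP)·∇)(AwP) = A ∘ ((w·∇)w) ∘ P` for `C¹`
fields. [folklore] -/
theorem convect_conj_swap {w : UnitAddTorus (Fin 3) → EuclideanSpace ℝ (Fin 3)}
    (hw : IsContDiff 1 w) (x : UnitAddTorus (Fin 3)) :
    convect
        (fun y : UnitAddTorus (Fin 3) =>
          LinearIsometryEquiv.piLpCongrLeft 2 ℝ ℝ (Equiv.swap (0 : Fin 3) 2)
            (w (fun k => y (Equiv.swap (0 : Fin 3) 2 k))))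
        (fun y : UnitAddTorus (Fin 3) =>
          LinearIsometryEquiv.piLpCongrLeft 2 ℝ ℝ (Equiv.swap (0 : Fin 3) 2)
            (w (fun k => y (Equiv.swap (0 : Fin 3) 2 k)))) x =
      LinearIsometryEquiv.piLpCongrLeft 2 ℝ ℝ (Equiv.swap (0 : Fin 3) 2)
        (convect w w (fun k => x (Equiv.swap (0 : Fin 3) 2 k))) := by
  simp only [Torus.convect]
  rw [← lineDeriv_eq_fderiv_apply (isContDiff_conj_swap hw), ← lineDeriv_eq_fderiv_apply hw,
    lineDeriv_piLpCongrLeft_comp, lineDeriv_comp_swap, piLpCongrLeft_swap_swap]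

/-- **Laplacian of conjugated fields**: `Δ(A ∘ w ∘ P) = A ∘ (Δw) ∘ P` for smooth fields
(`Δ = ∑ᵢ ∂ᵢ∂ᵢ`, reindexed by `σ`). [folklore] -/
theorem laplacian_conj_swap {w : UnitAddTorus (Fin 3) → EuclideanSpace ℝ (Fin 3)}
    (hw : IsSmooth w) (x : UnitAddTorus (Fin 3)) :
    Torus.laplacian (fun y : UnitAddTorus (Fin 3) =>
        LinearIsometryEquiv.piLpCongrLeft 2 ℝ ℝ (Equiv.swap (0 : Fin 3) 2)
          (w (fun k => y (Equiv.swap (0 : Fin 3) 2 k)))) x =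
      LinearIsometryEquiv.piLpCongrLeft 2 ℝ ℝ (Equiv.swap (0 : Fin 3) 2)
        (Torus.laplacian w (fun k => x (Equiv.swap (0 : Fin 3) 2 k))) := by
  rw [laplacian_eq_sum_partialDeriv_partialDeriv (isContDiff_conj_swap hw),
    laplacian_eq_sum_partialDeriv_partialDeriv hw, map_sum]
  simp only [partialDeriv_conj_swap]
  exact Equiv.sum_comp (Equiv.swap (0 : Fin 3) 2)
    (fun j => LinearIsometryEquiv.piLpCongrLeft 2 ℝ ℝ (Equiv.swap (0 : Fin 3) 2)
      (partialDeriv j (partialDeriv j w) (fun k => x (Equiv.swap (0 : Fin 3) 2 k))))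

/-- **Gradient of `q ∘ P`**: `∇(q ∘ P) = A ∘ (∇q) ∘ P` for `C¹` scalars (coordinatewise,
`(∇θ)ⱼ = ∂ⱼθ`). [folklore] -/
theorem gradient_comp_swap {q : UnitAddTorus (Fin 3) → ℝ} (hq : IsContDiff 1 q)
    (x : UnitAddTorus (Fin 3)) :
    Torus.gradient
        (fun y : UnitAddTorus (Fin 3) => q (fun k => y (Equiv.swap (0 : Fin 3) 2 k))) x =
      LinearIsometryEquiv.piLpCongrLeft 2 ℝ ℝ (Equiv.swap (0 : Fin 3) 2)
        (Torus.gradient q (fun k => x (Equiv.swap (0 : Fin 3) 2 k))) := by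
  ext j
  simp only [LinearIsometryEquiv.piLpCongrLeft_apply, Equiv.piCongrLeft'_apply, Equiv.symm_swap]
  rw [gradient_apply (isContDiff_comp_swap hq), gradient_apply hq, partialDeriv_comp_swap]

/-- **Equivariance of steady Navier–Stokes states under the swap**: if `V` is a smooth steady
state of `NS_ν(G)` with pressure `p`, then `A ∘ V ∘ P` is a smooth steady state of
`NS_ν(A ∘ G ∘ P)` with pressure `p ∘ P`. [folklore] -/
theorem isSteadyNSState_conj_swap {ν : ℝ} {G V : UnitAddTorus (Fin 3) → EuclideanSpace ℝ (Fin 3)}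
    {p : UnitAddTorus (Fin 3) → ℝ} (h : IsSteadyNSState ν G V p) :
    IsSteadyNSState ν
      (fun x : UnitAddTorus (Fin 3) =>
        LinearIsometryEquiv.piLpCongrLeft 2 ℝ ℝ (Equiv.swap (0 : Fin 3) 2)
          (G (fun k => x (Equiv.swap (0 : Fin 3) 2 k))))
      (fun x : UnitAddTorus (Fin 3) =>
        LinearIsometryEquiv.piLpCongrLeft 2 ℝ ℝ (Equiv.swap (0 : Fin 3) 2)
          (V (fun k => x (Equiv.swap (0 : Fin 3) 2 k))))
      (fun x : UnitAddTorus (Fin 3) => p (fun k => x (Equiv.swap (0 : Fin 3) 2 k))) := by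
  unfold IsSteadyNSState at h ⊢
  obtain ⟨hsv, hsp, hmom, hdiv⟩ := h
  have hV : IsSmooth V := hsv.isSmooth_slice (Set.mem_univ 0)
  have hp : IsSmooth p := hsp.isSmooth_slice (Set.mem_univ 0)
  refine ⟨isSmoothSpaceTimeOn_const (isContDiff_conj_swap hV) _,
    isSmoothSpaceTimeOn_const (isContDiff_comp_swap hp) _, fun t _ x => ?_,
    fun t _ x => (divergence_conj_swap V x).trans (hdiv 0 (Set.mem_univ 0) _)⟩
  have hm := hmom t (Set.mem_univ t) (fun k => x (Equiv.swap (0 : Fin 3) 2 k))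
  simp only [Torus.timeDerivWithin, derivWithin_fun_const, Pi.zero_apply, zero_add] at hm ⊢
  rw [convect_conj_swap (hV.isContDiff (by simp)) x, laplacian_conj_swap hV x,
    gradient_comp_swap (hp.isContDiff (by simp)) x, hm, map_add, map_sub,
    LinearIsometryEquiv.map_smul]

/-- **The registered stub `stub_axisZeroOfAxisTwo`**: a columnar bounded-energy
vanishing-viscosity steady branch on `T³` with invariant axis `2` (force `G`, states `V_j`,
pressures `p_j`, viscosities `ν_j → 0⁺`, energy bound `E`) yields one with invariant axis `0`,
namely the conjugated branch `(A ∘ G ∘ P, A ∘ V_j ∘ P, p_j ∘ P)` under the coordinate swap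
`σ = (0 2)` (`P x = x ∘ σ`, `(A w) i = w (σ i)`), with the same `ν_j` and `E`. [folklore] -/
theorem stub_axisZeroOfAxisTwo :
    (∃ G : UnitAddTorus (Fin 3) → EuclideanSpace ℝ (Fin 3), IsSmooth G ∧
      (∀ (s : UnitAddCircle) x, G (x + Pi.single (2 : Fin 3) s) = G x) ∧
      (∀ x, G x 2 = 0) ∧ IsDivFree G ∧ HasZeroMean G ∧ G ≠ 0 ∧
      ∃ (ν : ℕ → ℝ) (V : ℕ → UnitAddTorus (Fin 3) → EuclideanSpace ℝ (Fin 3))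
        (p : ℕ → UnitAddTorus (Fin 3) → ℝ),
        (∀ j, 0 < ν j) ∧ Tendsto ν atTop (𝓝 0) ∧
        (∀ j, IsSteadyNSState (ν j) G (V j) (p j)) ∧
        (∀ j (s : UnitAddCircle) x, V j (x + Pi.single (2 : Fin 3) s) = V j x) ∧
        (∀ j x, V j x 2 = 0) ∧ (∀ j, HasZeroMean (V j)) ∧
        ∃ E : ℝ, ∀ j, ∫ x, ‖V j x‖ ^ 2 ≤ E) →
    ∃ G : UnitAddTorus (Fin 3) → EuclideanSpace ℝ (Fin 3), IsSmooth G ∧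
      (∀ (s : UnitAddCircle) x, G (x + Pi.single (0 : Fin 3) s) = G x) ∧
      (∀ x, G x 0 = 0) ∧ IsDivFree G ∧ HasZeroMean G ∧ G ≠ 0 ∧
      ∃ (ν : ℕ → ℝ) (V : ℕ → UnitAddTorus (Fin 3) → EuclideanSpace ℝ (Fin 3))
        (p : ℕ → UnitAddTorus (Fin 3) → ℝ),
        (∀ j, 0 < ν j) ∧ Tendsto ν atTop (𝓝 0) ∧
        (∀ j, IsSteadyNSState (ν j) G (V j) (p j)) ∧
        (∀ j (s : UnitAddCircle) x, V j (x + Pi.single (0 : Fin 3) s) = V j x) ∧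
        (∀ j x, V j x 0 = 0) ∧ (∀ j, HasZeroMean (V j)) ∧
        ∃ E : ℝ, ∀ j, ∫ x, ‖V j x‖ ^ 2 ≤ E := by
  rintro ⟨G, hG, hGinv, hG2, hGdiv, hGmean, hGne, ν, V, p, hν, hν0, hst, hVinv, hV2, hVmean, E,
    hE⟩
  refine ⟨fun x : UnitAddTorus (Fin 3) =>
      LinearIsometryEquiv.piLpCongrLeft 2 ℝ ℝ (Equiv.swap (0 : Fin 3) 2)
        (G (fun k => x (Equiv.swap (0 : Fin 3) 2 k))),
    isContDiff_conj_swap hG, fun s x => congrArg _ (comp_swap_add_single_zero G hGinv s x),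
    fun x => ?_, fun x => (divergence_conj_swap G x).trans (hGdiv _),
    hasZeroMean_conj_swap hGmean, fun h0 => hGne ?_, ν,
    fun j x => LinearIsometryEquiv.piLpCongrLeft 2 ℝ ℝ (Equiv.swap (0 : Fin 3) 2)
      (V j (fun k => x (Equiv.swap (0 : Fin 3) 2 k))),
    fun j x => p j (fun k => x (Equiv.swap (0 : Fin 3) 2 k)), hν, hν0,
    fun j => isSteadyNSState_conj_swap (hst j),
    fun j s x => congrArg _ (comp_swap_add_single_zero (V j) (hVinv j) s x), fun j x => ?_,
    fun j => hasZeroMean_conj_swap (hVmean j), E, fun j => ?_⟩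
  · -- vanishing component `0` of the force: `(A w) 0 = w 2`
    simp only [LinearIsometryEquiv.piLpCongrLeft_apply, Equiv.piCongrLeft'_apply, Equiv.symm_swap,
      Equiv.swap_apply_left, hG2]
  · -- the force is nonzero
    funext y
    have h1 := congrFun h0 (fun i => y (Equiv.swap (0 : Fin 3) 2 i))
    simp only [swap_swap_coord, Pi.zero_apply] at h1
    have h2 := congrArg (LinearIsometryEquiv.piLpCongrLeft 2 ℝ ℝ (Equiv.swap (0 : Fin 3) 2)) h1
    rw [piLpCongrLeft_swap_swap, map_zero] at h2
    exact h2
  · -- vanishing component `0` of the states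
    simp only [LinearIsometryEquiv.piLpCongrLeft_apply, Equiv.piCongrLeft'_apply, Equiv.symm_swap,
      Equiv.swap_apply_left, hV2]
  · -- the energy bound
    rw [integral_norm_sq_conj_swap]
    exact hE j

end Summit.AnomalousDissipation.AnomalousDissipation.Theorems

end
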